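import Literature.AlgebraicGeometry.DuqueFrancoVillaflor2025.SplitHypersurfaceFakeLinearCycles
import Literature.AlgebraicGeometry.DuqueFrancoVillaflor2025.ZeroDimensionalFakeQuadraticForm
import HarnessLib

/-!
# The quadratic fundamental form of a join with a fake `0`-dimensional factor does not vanish in degree `d`
# (Duque Franco–Villaflor 2025, Thm. 7.2 via Thm. 1.3 [arXiv v4: Thm. 4.1], eq. (eqQFFjoin)) — algebraic core

Certified instances and evidence bearing on the general Hodge conjecture; no claim.

J. Duque Franco, R. Villaflor Loyola, *Periods of join algebraic cycles*, Ann. Sc. Norm. Super. Pisa (2025)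
= arXiv:2312.17222 [DuqueFrancoVillaflor2025Join] (held text `paper:arxiv-2312.17222` = arXiv v1–v3 numbering;
§2, §6, §7 numbers identical in v4). **Theorem 7.2** (p. 19, verbatim): "Let `n` an even number and
`d ≥ 2 + 6/n` an integer. For any degree `d` homogeneous polynomials `F_0, …, F_{n/2} ∈ ℚ[x,y]_d` with no
multiple roots, let `X = {F_0(x_0,x_1) + F_1(x_2,x_3) + ⋯ + F_{n/2}(x_n,x_{n+1}) = 0} ⊆ ℙ^{n+1}`. For each
`i = 0, …, n/2` consider `X_i := {F_i(x_{2i},x_{2i+1}) = 0} ⊆ ℙ¹` and some `δ_i ∈ H⁰(X_i,ℚ)_prim` with `HF_{δ_i}`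
equal to the Hilbert function of a point. Let `δ := J(δ_1, …, δ_{n/2})`, then `δ` is a fake linear cycle if and
only if `V_δ` is not smooth" (v4: "… is not non-reduced or is reduced and singular at `X`"). **Proof** (p. 19–20,
verbatim): "… If some `δ_i` is a `0`-dimensional fake linear cycle, then … `q_i(x_{2i} − cx_{2i+1},
x_{2i} − cx_{2i+1}) = a + bc = d·F_i(c,1) ≠ 0`. Using that `d ≥ 2 + 6/n` we can apply (corqff) (ii) with the
values `e = d`, `ℓ = 1`, `j = 2d − 5`, `k = 0` to conclude that the quadratic fundamental form `q` associated to
`V_δ` is non-zero in degree `d`, and so `V_δ` is not smooth." Here (corqff) = **Theorem 1.3** [arXiv v4: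
Theorem 4.1], eq. (eqQFFjoin): for `G = A_1G_1(x) + A_2G_2(y)`, `H = B_1H_1(x) + B_2H_2(y) ∈ J^{f+g,[J(Z_1,Z_2)]}`,
"`q(G,H) = A_1B_1P_{Z_2}q_1(G_1,H_1) + A_2B_2P_{Z_1}q_2(G_2,H_2)`", with `q` Maclean's form of **Theorem 2.1**,
eq. (eqQFF): `q(G,H) = Σ_i (H ∂Q_i/∂x_i − R_i ∂G/∂x_i)`, `G·P_λ = Σ_i Q_i ∂F/∂x_i`, `H·P_λ = Σ_i R_i ∂F/∂x_i`, values
in `R^F/⟨P_λ⟩` — the tree's `DuqueFrancoVillaflor2023.macleanForm`. The `0`-dimensional step is the tree file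
`ZeroDimensionalFakeQuadraticForm.lean` (`macleanForm_pointForm`: `q_i(L,L) = −(a + bc) = −d·F_i(c,1)`,
`L = x_{2i} − cx_{2i+1}`; the printed sign is immaterial).

## What this file PROVES (0 facts, 0 sorry), over any field `K`

The DIRECTION "some `δ_i` fake ⟹ `q_δ ≠ 0` in degree `d`" of Thm. 7.2, at the level of polynomials, for the
join `F = g(x) + f(y₀,y₁)` (`joinForm g f`; variables `σ ⊔ Fin 2`) of ANY form `g` with Artinian Gorenstein
Jacobian ideal (smooth `{g = 0}`) with a binary form `f` (the fake block; the order of the blocks is immaterial):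
* `joinLift` — Maclean lifts of `G = A·L` (`L = y₀ − cy₁`) for `P_δ = P₂(x)·P₁(y)`: `𝒬_{y_i} = A·P₂·Q_i` with
  DFV's constants `(Q₀,Q₁) = (a, −b)` (tree `dfvLift`), `𝒬_{x} = 0`; `mul_pointForm_mul_eq_sum_joinLift`:
  `G·P_δ = Σ_z 𝒬_z ∂F/∂z` (legitimacy, for every `P₁` with `P₁L = aF_{y₀} − bF_{y₁}`); `mul_pointForm_mem_colon`:
  `G ∈ (J^F : P_δ)` (`= J^{F,δ}` by Thm. 1.1, tree `IsArtinianGorenstein.colon_join`);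
* **`macleanForm_join_pointForm`** — eq. (eqQFFjoin) in the case needed, as an EXACT identity of polynomials:
  `q(A·L, B·L) = A·B·P₂(x)·q_i(L,L) = −(a + bc)·A·B·P₂` (`= −d·f(c,1)·A·B·P₂`, `macleanForm_join_pointForm_eq`);
* **`rename_mul_rename_notMem_sup_span`** — the duality step: with `J^g = Ann ℓ_g`, `J^f = Ann ℓ_f` (Macaulay) and
  `J^{g+f} = Ann(ℓ_g ⊗ ℓ_f)` (Thm. 1.1, tree `annIdeal_tensorFunctional`), if `w₁P₁ ∈ J^f`, `ℓ_f(v w₁) ≠ 0` and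
  `ℓ_g(u P₂ w₂) ≠ 0` then `u(x)P₂(x)·v(y) ∉ J^{g+f} + ⟨P₂P₁⟩` (witness functional `(ℓ_g ⊗ ℓ_f)(· w₂w₁)`);
* `exists_monomial_apply_mul_pointForm_ne_zero` (`f`-side: a monomial `y^s` of degree `2d − 5` with
  `ℓ_f(y^s L) ≠ 0`, from Def. 2.1 (iii) and `L ∉ J^f`, `pointForm_notMem_jacobianIdeal`),
  `exists_monomial_apply_mul_mul_ne_zero` (`g`-side: from a form `v` of degree `3` with `vP₂ ∉ J^g`, a monomial
  `x^β` and `w₂` with `ℓ_g(x^βP₂w₂) ≠ 0`) — the degrees `j = 2d − 5` and `2(e−ℓ) − j = 3` of the printed proof;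
* **`exists_macleanForm_join_notMem`** (MAIN): for `f` of degree `d ≥ 3` with `J^f` Artinian Gorenstein of socle
  `2(d−2)`, `d·f(c,1) ≠ 0` (fake `δ_i`), `P₁L = aF_{y₀} − bF_{y₁}`, `J^g` Artinian Gorenstein, `P₂` a form, and
  SOME form `v` of degree `3` with `vP₂ ∉ J^g` ("`HF_{δ'}(3) ≠ 0`"): there are monomials `A, B` of degree `d − 1`
  (a splitting `x^βy^s = A·B`) such that `G = A·L`, `H = B·L` are forms of degree `d` in `(J^F : P_δ)` with
  legitimate lifts and `q(G,H) = −d·f(c,1)·x^βP₂·y^s ∉ J^F + ⟨P_δ⟩`;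
* `exists_isHomogeneous_three_mul_prod_notMem`: for `g = Σ_{j<m} F_j(x_{(j,·)})` (tree `blockSum`) and `P₂ = ∏_j P_j`
  a join of `m` point-type classes, "`HF_{δ'}(3) ≠ 0`" holds iff `3 ≤ m(d−2)` — the printed `d ≥ 2 + 6/n`,
  `n = 2m` (tree `hilbert_blockSumJacobian_colon`: `HF_{δ'} = ciHilbert [(d−1)^m]`);
* **`splitHypersurface_macleanForm_notMem`** — Thm. 7.2's non-vanishing on the printed
  `X = {Σ_{j<m} ∏_i(x_{(j,0)} − r_{j,i}x_{(j,1)}) + ∏_i(y₀ − r_iy₁) = 0}` (all roots simple, `d ≥ 3`, `d ≠ 0` in `K`,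
  `3 ≤ m(d−2)`), the last block carrying the fake `δ_m` (`c ∉ {r_i}`), the others any point-type classes.

Not formalised (cited): Maclean's theorem (that `q`, computed with any lifts, is the quadratic fundamental form
of `V_δ`, well defined on `R^F/⟨P_δ⟩`, and vanishes when `V_δ` is smooth of dimension `dim T_0V_δ`) [Maclean 2005;
DFV Thm. 2.1, Rem. 2.2]; the general (eqQFFjoin) with its Koszul step and Thm. 1.3 (i)–(ii) as printed; the
converse direction of Thm. 7.2 ("all `δ_i` genuine ⟹ `V_δ` smooth", known for linear cycles).

## References

* [DuqueFrancoVillaflor2025Join] Thm. 7.2 with proof (§7, pp. 19–20), Thm. 1.3 / eq. (eqQFFjoin) and the proof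
  of (ii) (§4, p. 11; = Thm. 4.1 of arXiv v4), Thm. 2.1 eq. (eqQFF), Def. 2.1 (iii), Thm. 1.1, Thm. 7.1, Ex. 6.1.
* [DuquefrancoVillaflorloyola2023] Thm. 6.1 (Maclean's formula; tree `macleanForm`).
-/

noncomputable section

open MvPolynomial Module
open Literature.RingTheory.MvPolynomial Literature.AlgebraicGeometry.Kloosterman2023
open Literature.AlgebraicGeometry.Kloosterman2025
open Literature.AlgebraicGeometry.HodgeTheory
open Literature.AlgebraicGeometry.Motives.UniversalHypersurface
open Literature.AlgebraicGeometry.DuqueFrancoVillaflor2023 (macleanForm)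

attribute [local instance] MvPolynomial.gradedAlgebra

namespace Literature.AlgebraicGeometry.DuqueFrancoVillaflor2025

universe u v

variable {K : Type u} [Field K] {σ : Type v} {d : ℕ}

/-! ## The join `F = g(x) + f(y₀,y₁)` of a hypersurface `{g = 0}` with a binary form, and Maclean's lifts -/

section JoinForm

variable (g : MvPolynomial σ K) (f : MvPolynomial (Fin 2) K)

/-- **`F = g(x) + f(y₀, y₁)`**: the sum of a form `g` in the variables `x` (`Sum.inl`) and a binary form `f` in two
further variables (`Sum.inr 0, Sum.inr 1`) — DFV's decomposable `f + g` (Thm. 1.1–1.3) with one summand a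
`0`-dimensional hypersurface `X_i = {F_i(x_{2i},x_{2i+1}) = 0} ⊂ ℙ¹` (proof of Thm. 7.2).
[cite: DuqueFrancoVillaflor2025Join, Theorem 1.3 (= Theorem 4.1 of arXiv v4) and Theorem 7.2 (proof)] -/
def joinForm : MvPolynomial (σ ⊕ Fin 2) K := rename Sum.inl g + rename Sum.inr f

/-- Its Jacobian ideal `J^{g+f} = ⟨∂(g+f)/∂z : z⟩` (`= J^g S + J^f S`, tree `span_pderiv_sebastianiThom`).
[cite: DuqueFrancoVillaflor2025Join, Theorem 1.1 (proof)] -/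
def joinJacobian : Ideal (MvPolynomial (σ ⊕ Fin 2) K) :=
  Ideal.span (Set.range fun z : σ ⊕ Fin 2 => pderiv z (joinForm g f))

/-- `J^{g+f} = J^g·S + J^f·S`. [cite: DuqueFrancoVillaflor2025Join, Theorem 1.1 (proof)] -/
theorem joinJacobian_eq_sup :
    joinJacobian g f = (Ideal.span (Set.range fun i : σ => pderiv i g)).map (rename Sum.inl) ⊔
      (jacobianIdeal f).map (rename Sum.inr : MvPolynomial (Fin 2) K →ₐ[K] MvPolynomial (σ ⊕ Fin 2) K) :=
  span_pderiv_sebastianiThom g f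

/-- `∂(g + f)/∂y_i = (∂f/∂y_i)(y)`: the `y`-partials of the join are those of `f`. [cite: DuqueFrancoVillaflor2025Join, Theorem 1.1 (proof)] -/
theorem pderiv_inr_joinForm (i : Fin 2) :
    pderiv (Sum.inr i) (joinForm g f) = rename Sum.inr (pderiv i f) := by
  classical
  have hnot : Sum.inr i ∉ (rename Sum.inl g : MvPolynomial (σ ⊕ Fin 2) K).vars := by
    intro hmem
    obtain ⟨j, -, hj⟩ := Finset.mem_image.mp (vars_rename Sum.inl g hmem)
    exact Sum.inl_ne_inr hj
  rw [joinForm, map_add, pderiv_eq_zero_of_notMem_vars hnot, zero_add, pderiv_rename Sum.inr_injective]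

/-- A polynomial in the `x`-variables has no `y`-derivatives. [folklore] -/
private theorem pderiv_inr_rename_inl (i : Fin 2) (P : MvPolynomial σ K) :
    pderiv (Sum.inr i) (rename Sum.inl P : MvPolynomial (σ ⊕ Fin 2) K) = 0 := by
  classical
  refine pderiv_eq_zero_of_notMem_vars fun hmem => ?_
  obtain ⟨j, -, hj⟩ := Finset.mem_image.mp (vars_rename Sum.inl P hmem)
  exact Sum.inl_ne_inr hj

/-- **Maclean's lifts for `G = A·(y₀ − cy₁)` on the join.** With `P_δ = P₂(x)·P₁(y)` and DFV's constant lifts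
`(a, −b)` of `y₀ − cy₁` on the binary block (`(y₀ − cy₁)P₁ = aF_{y₀} − bF_{y₁}`):
`G·P_δ = Σ_i (A·P₂(x)·Q_i)·∂F/∂y_i`, so `𝒬_{y_i} = A·P₂·Q_i` and `𝒬_{x_j} = 0`.
[cite: DuqueFrancoVillaflor2025Join, Theorem 1.3 (proof; = Theorem 4.1 of arXiv v4) and Theorem 7.2 (proof)] -/
def joinLift (c : K) (P₂ : MvPolynomial σ K) (A : MvPolynomial (σ ⊕ Fin 2) K) :
    σ ⊕ Fin 2 → MvPolynomial (σ ⊕ Fin 2) K :=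
  Sum.elim (fun _ => 0) fun i => A * rename Sum.inl P₂ * rename Sum.inr (dfvLift f c i)

variable {g f}

/-- **The lifts are legitimate**: for every `P₁` with `P₁·(y₀ − cy₁) = aF_{y₀} − bF_{y₁}` (DFV's `P` of Thm. 7.1),
`(A·(y₀ − cy₁))·(P₂(x)P₁(y)) = Σ_z 𝒬_z ∂(g+f)/∂z`. [cite: DuqueFrancoVillaflor2025Join, Theorem 1.3 (proof; = Theorem 4.1 of arXiv v4)] -/
theorem mul_pointForm_mul_eq_sum_joinLift [Fintype σ] {c : K} {P₁ : MvPolynomial (Fin 2) K}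
    (hP : P₁ * pointForm c = dfvNumerator f c) (P₂ : MvPolynomial σ K) (A : MvPolynomial (σ ⊕ Fin 2) K) :
    A * rename Sum.inr (pointForm c) * (rename Sum.inl P₂ * rename Sum.inr P₁) =
      ∑ z, joinLift f c P₂ A z * pderiv z (joinForm g f) := by
  rw [Fintype.sum_sum_type]
  simp only [joinLift, Sum.elim_inl, zero_mul, Finset.sum_const_zero, zero_add, Sum.elim_inr,
    pderiv_inr_joinForm]
  have h := congrArg (rename (Sum.inr : Fin 2 → σ ⊕ Fin 2) (R := K)) (pointForm_mul_eq_sum_dfvLift (F := f) hP)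
  rw [map_sum] at h
  simp only [map_mul] at h
  calc A * rename Sum.inr (pointForm c) * (rename Sum.inl P₂ * rename Sum.inr P₁)
      = A * rename Sum.inl P₂ * (rename Sum.inr (pointForm c) * rename Sum.inr P₁) := by ring
    _ = A * rename Sum.inl P₂ * ∑ i, rename Sum.inr (dfvLift f c i) * rename Sum.inr (pderiv i f) := by rw [h]
    _ = ∑ i, A * rename Sum.inl P₂ * rename Sum.inr (dfvLift f c i) * rename Sum.inr (pderiv i f) := by
      rw [Finset.mul_sum]
      refine Finset.sum_congr rfl fun i _ => ?_
      ring

/-- **`G = A·(y₀ − cy₁)` lies in `(J^{g+f} : P₂(x)P₁(y))`** (`= J^{F,δ}` for `δ = J(δ', δ_i)`, Thm. 1.1): indeed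
`G·P₂P₁ ∈ J^{g+f}`. [cite: DuqueFrancoVillaflor2025Join, Theorem 1.1 and Theorem 7.2 (proof)] -/
theorem mul_pointForm_mem_colon [Fintype σ] {c : K} {P₁ : MvPolynomial (Fin 2) K}
    (hP : P₁ * pointForm c = dfvNumerator f c) (P₂ : MvPolynomial σ K) (A : MvPolynomial (σ ⊕ Fin 2) K) :
    A * rename Sum.inr (pointForm c) ∈ (joinJacobian g f).colon {rename Sum.inl P₂ * rename Sum.inr P₁} := by
  rw [Submodule.mem_colon_singleton, smul_eq_mul, mul_pointForm_mul_eq_sum_joinLift hP]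
  exact Ideal.sum_mem _ fun z _ => Ideal.mul_mem_left _ _ (Ideal.subset_span ⟨z, rfl⟩)

/-- **eq. (eqQFFjoin) for `G = A·L`, `H = B·L`, `L = y₀ − cy₁` — an exact polynomial identity:**
`q(A·L, B·L) = A·B·P₂(x)·q_i(L, L) = −(a + bc)·A·B·P₂(x)` (Maclean's eq. (eqQFF) `Σ_z (H ∂_z𝒬_z − ℛ_z ∂_zG)`
with the lifts `joinLift`; the cross terms `B·P₂·Σ_i (L·Q_i − Q_i·L)·∂A/∂y_i` of the printed proof vanish
identically here since `G₁ = H₁ = L`). [cite: DuqueFrancoVillaflor2025Join, Theorem 1.3, eq. (eqQFFjoin) (= Theorem 4.1 of arXiv v4) and Theorem 7.2 (proof)] -/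
theorem macleanForm_join_pointForm [Fintype σ] (c : K) (P₂ : MvPolynomial σ K)
    (A B : MvPolynomial (σ ⊕ Fin 2) K) :
    macleanForm (A * rename Sum.inr (pointForm c)) (B * rename Sum.inr (pointForm c)) (joinLift f c P₂ A)
        (joinLift f c P₂ B) =
      -C (c * eval ![c, 1] (pderiv 0 f) + eval ![c, 1] (pderiv 1 f)) * (A * B * rename Sum.inl P₂) := by
  have h0 : pderiv (Sum.inr 0) (rename Sum.inr (pointForm c) : MvPolynomial (σ ⊕ Fin 2) K) = 1 := by
    rw [pderiv_rename Sum.inr_injective, pointForm, map_sub, pderiv_X_self, pderiv_C_mul,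
      pderiv_X_of_ne (by decide : (1 : Fin 2) ≠ 0), mul_zero, sub_zero, map_one]
  have h1 : pderiv (Sum.inr 1) (rename Sum.inr (pointForm c) : MvPolynomial (σ ⊕ Fin 2) K) = -C c := by
    rw [pderiv_rename Sum.inr_injective, pointForm, map_sub, pderiv_X_of_ne (by decide : (0 : Fin 2) ≠ 1),
      pderiv_C_mul, pderiv_X_self, mul_one, zero_sub, map_neg, rename_C]
  rw [macleanForm, Fintype.sum_sum_type]
  simp only [joinLift, Sum.elim_inl, map_zero, mul_zero, zero_mul, sub_zero, Finset.sum_const_zero, zero_add,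
    Sum.elim_inr, Fin.sum_univ_two, dfvLift_zero, dfvLift_one, rename_C, map_neg, pderiv_mul, pderiv_C,
    pderiv_inr_rename_inl, h0, h1, mul_one, add_zero]
  rw [C_add, C_mul]
  ring

/-- … `= −d·f(c,1)·A·B·P₂(x)` for `f` homogeneous of degree `d` ("`a + bc = d·F_i(c,1)`", Euler).
[cite: DuqueFrancoVillaflor2025Join, Theorem 7.2 (proof)] -/
theorem macleanForm_join_pointForm_eq [Fintype σ] (hf : f.IsHomogeneous d) (c : K) (P₂ : MvPolynomial σ K)
    (A B : MvPolynomial (σ ⊕ Fin 2) K) :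
    macleanForm (A * rename Sum.inr (pointForm c)) (B * rename Sum.inr (pointForm c)) (joinLift f c P₂ A)
        (joinLift f c P₂ B) =
      -C ((d : K) * eval ![c, 1] f) * (A * B * rename Sum.inl P₂) := by
  rw [macleanForm_join_pointForm, euler_eval_point hf c]

end JoinForm

/-! ## The witness functional: `u(x)P₂(x)·v(y) ∉ J^{g+f} + ⟨P₂P₁⟩` -/

section Witness

/-- **Non-membership in `J^F + ⟨P_δ⟩` through the socle functional of `R^F = R^g ⊗ R^f`.** Let `J^g = Ann(ℓ_g)`,
`J^f = Ann(ℓ_f)` (Macaulay; `ℓ_f` concentrated in one degree), so that `J^{g+f} = Ann(ℓ_g ⊗ ℓ_f)` (Thm. 1.1). If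
`w₁P₁ ∈ J^f` and `ℓ_f(v·w₁) ≠ 0`, and `ℓ_g(u·P₂·w₂) ≠ 0`, then the functional `Φ = (ℓ_g ⊗ ℓ_f)(· w₂(x)w₁(y))`
kills `J^{g+f} + ⟨P₂(x)P₁(y)⟩` but not `u(x)P₂(x)·v(y)`: so `u P₂·v ∉ J^{g+f} + ⟨P₂P₁⟩` — it is non-zero in
`R^{g+f}/⟨P_δ⟩`. (The duality step behind "then there exists some `T(x,y)` … such that
`P_{Z₂}(Q·S·q₁ − T·P_{Z₁}) ∈ J^{f+g}`" in the proof of Thm. 1.3 (ii), run in the direction we need.)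
[cite: DuqueFrancoVillaflor2025Join, Theorem 1.3 (proof of (ii); = Theorem 4.1 of arXiv v4) and Theorem 1.1] -/
theorem rename_mul_rename_notMem_sup_span {tf : ℕ} {ℓg : MvPolynomial σ K →ₗ[K] K}
    {ℓf : MvPolynomial (Fin 2) K →ₗ[K] K} (hℓf : ∀ p, ℓf (homogeneousComponent tf p) = ℓf p)
    {u P₂ w₂ : MvPolynomial σ K} {v P₁ w₁ : MvPolynomial (Fin 2) K} (hw₁ : w₁ * P₁ ∈ annIdeal ℓf)
    (hv : ℓf (v * w₁) ≠ 0) (hu : ℓg (u * P₂ * w₂) ≠ 0) :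
    rename Sum.inl (u * P₂) * rename Sum.inr v ∉
      ((annIdeal ℓg).map (rename Sum.inl) ⊔ (annIdeal ℓf).map (rename Sum.inr) :
          Ideal (MvPolynomial (σ ⊕ Fin 2) K)) ⊔
        Ideal.span {rename Sum.inl P₂ * rename Sum.inr P₁} := by
  -- the witness functional `Φ = (ℓ_g ⊗ ℓ_f)(· w₂(x) w₁(y)) = ℓ_g(· w₂) ⊗ ℓ_f(· w₁)`
  set Φ : MvPolynomial (σ ⊕ Fin 2) K →ₗ[K] K :=
    tensorFunctional ℓg ℓf ∘ₗ LinearMap.mulRight K (rename Sum.inl w₂ * rename Sum.inr w₁) with hΦ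
  have hAnn : annIdeal (tensorFunctional ℓg ℓf) =
      (annIdeal ℓg).map (rename Sum.inl) ⊔ (annIdeal ℓf).map (rename Sum.inr) :=
    annIdeal_tensorFunctional_of_homogeneousComponent (ℓ₁ := ℓg) hℓf
  -- `Φ` kills `J^{g+f}`
  have hkill₁ : ∀ z ∈ ((annIdeal ℓg).map (rename Sum.inl) ⊔ (annIdeal ℓf).map (rename Sum.inr) :
      Ideal (MvPolynomial (σ ⊕ Fin 2) K)), Φ z = 0 := by
    intro z hz
    rw [← hAnn] at hz
    exact mem_annIdeal_iff.mp hz _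
  -- `Φ` kills `⟨P₂ P₁⟩`: `P₂P₁·r·w₂w₁ = (P₂ r w₂)(x…)·` contains the factor `(w₁P₁)(y) ∈ J^f·S ⊆ Ann(ℓ_g ⊗ ℓ_f)`
  have hkill₂ : ∀ z ∈ Ideal.span {rename Sum.inl P₂ * rename Sum.inr P₁}, Φ z = 0 := by
    intro z hz
    obtain ⟨r, rfl⟩ := Ideal.mem_span_singleton'.mp hz
    simp only [hΦ, LinearMap.coe_comp, Function.comp_apply, LinearMap.mulRight_apply]
    have hmem : rename Sum.inr (w₁ * P₁) ∈ annIdeal (tensorFunctional ℓg ℓf) := by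
      rw [hAnn]
      exact Ideal.mem_sup_right (Ideal.mem_map_of_mem _ hw₁)
    have : r * (rename Sum.inl P₂ * rename Sum.inr P₁) * (rename Sum.inl w₂ * rename Sum.inr w₁) =
        (r * rename Sum.inl P₂ * rename Sum.inl w₂) * rename Sum.inr (w₁ * P₁) := by
      rw [map_mul]; ring
    rw [this, mul_comm]
    exact apply_eq_zero_of_mem_annIdeal (Ideal.mul_mem_right _ _ hmem)
  -- but `Φ(u P₂ · v) = ℓ_g(u P₂ w₂)·ℓ_f(v w₁) ≠ 0`
  have hval : Φ (rename Sum.inl (u * P₂) * rename Sum.inr v) = ℓg (u * P₂ * w₂) * ℓf (v * w₁) := by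
    simp only [hΦ, LinearMap.coe_comp, Function.comp_apply, LinearMap.mulRight_apply]
    rw [show rename Sum.inl (u * P₂) * rename Sum.inr v * (rename Sum.inl w₂ * rename Sum.inr w₁) =
        rename Sum.inl (u * P₂ * w₂) * rename (Sum.inr : Fin 2 → σ ⊕ Fin 2) (v * w₁) by
      simp only [map_mul]; ring, tensorFunctional_mul_rename]
  intro hmem
  obtain ⟨z₁, hz₁, z₂, hz₂, hsum⟩ := Submodule.mem_sup.mp hmem
  have h0 : Φ (rename Sum.inl (u * P₂) * rename Sum.inr v) = 0 := by
    rw [← hsum, map_add, hkill₁ z₁ hz₁, hkill₂ z₂ hz₂, add_zero]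
  rw [hval] at h0
  exact mul_ne_zero hu hv h0

end Witness

/-! ## Monomial witnesses -/

section Monomials

/-- If `ℓ(p·h) ≠ 0` then `ℓ(x^s·h) ≠ 0` for some monomial `x^s` in the support of `p`. [folklore] -/
private theorem exists_monomial_of_apply_mul_ne_zero {ι : Type*} (ℓ : MvPolynomial ι K →ₗ[K] K)
    {p h : MvPolynomial ι K} (hp : ℓ (p * h) ≠ 0) : ∃ s ∈ p.support, ℓ (monomial s 1 * h) ≠ 0 := by
  by_contra hcon
  push Not at hcon
  apply hp
  conv_lhs => rw [p.as_sum, Finset.sum_mul, map_sum]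
  refine Finset.sum_eq_zero fun s hs => ?_
  rw [show monomial s (coeff s p) * h = coeff s p • (monomial s 1 * h) by
    rw [← smul_mul_assoc, smul_monomial, smul_eq_mul, mul_one], map_smul, hcon s hs, smul_zero]

/-- A monomial in the support of a form of degree `n` has degree `n`. [folklore] -/
private theorem degree_eq_of_mem_support {ι : Type*} {p : MvPolynomial ι K} {n : ℕ} (hp : p.IsHomogeneous n)
    {s : ι →₀ ℕ} (hs : s ∈ p.support) : s.degree = n := by
  have := hp (mem_support_iff.mp hs)
  rwa [Finsupp.degree_eq_weight_one]

/-- **Splitting a monomial**: an exponent vector of degree `≥ p` dominates one of degree exactly `p`. [folklore] -/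
private theorem exists_le_degree_eq {ι : Type*} (m : ι →₀ ℕ) :
    ∀ p : ℕ, p ≤ m.degree → ∃ m₁ : ι →₀ ℕ, m₁ ≤ m ∧ m₁.degree = p
  | 0, _ => ⟨0, bot_le, by simp⟩
  | p + 1, hp => by
    classical
    obtain ⟨m₁, hle, hdeg⟩ := exists_le_degree_eq m p (by omega)
    have hne : m₁ ≠ m := by rintro rfl; omega
    obtain ⟨i, hi⟩ : ∃ i, m₁ i < m i := by
      by_contra hcon
      push Not at hcon
      exact hne (le_antisymm hle fun i => hcon i)
    refine ⟨m₁ + Finsupp.single i 1, fun j => ?_, by rw [map_add, hdeg, Finsupp.degree_single]⟩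
    by_cases hj : j = i
    · subst hj
      simp only [Finsupp.coe_add, Pi.add_apply, Finsupp.single_eq_same]
      omega
    · simp only [Finsupp.coe_add, Pi.add_apply, Finsupp.single_eq_of_ne hj, add_zero]
      exact hle j

/-- The degree-`k` component of `a·s` vanishes for a form `s` of degree `N > k`. [folklore] -/
private theorem homogeneousComponent_mul_eq_zero_of_lt' {ι : Type*} (a : MvPolynomial ι K)
    {s : MvPolynomial ι K} {N k : ℕ} (hs : s.IsHomogeneous N) (hk : k < N) :
    homogeneousComponent k (a * s) = 0 := by
  classical
  conv_lhs => rw [← sum_homogeneousComponent a, Finset.sum_mul, map_sum]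
  refine Finset.sum_eq_zero fun j _ => ?_
  have hmem : homogeneousComponent j a * s ∈ homogeneousSubmodule ι K (j + N) :=
    (mem_homogeneousSubmodule _ _).mpr ((homogeneousComponent_isHomogeneous j a).mul hs)
  rw [homogeneousComponent_of_mem hmem, if_neg (by omega)]

/-- **`y₀ − cy₁ ∉ J^f`** for a binary form `f` of degree `d ≥ 3`: `J^f` is generated in degree `d − 1 ≥ 2`.
[cite: DuqueFrancoVillaflor2025Join, Theorem 7.2 (proof: `x_{2i} − cx_{2i+1} ∈ J^{F_i,δ_i}_1`)] -/
theorem pointForm_notMem_jacobianIdeal {f : MvPolynomial (Fin 2) K} (hf : f.IsHomogeneous d) (hd : 3 ≤ d)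
    (c : K) : pointForm c ∉ jacobianIdeal f := by
  intro hmem
  rw [jacobianIdeal, Ideal.mem_span_range_iff_exists_fun] at hmem
  obtain ⟨a, ha⟩ := hmem
  have h1 : homogeneousComponent 1 (pointForm c : MvPolynomial (Fin 2) K) = pointForm c :=
    homogeneousComponent_eq_self ((isHomogeneous_X K 0).sub ((isHomogeneous_C _ c).mul (isHomogeneous_X K 1)))
  have h0 : homogeneousComponent 1 (∑ i, a i * pderiv i f) = 0 := by
    rw [map_sum]
    exact Finset.sum_eq_zero fun i _ =>
      homogeneousComponent_mul_eq_zero_of_lt' (a i) (hf.pderiv (i := i)) (by omega)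
  rw [ha, h1] at h0
  have := congrArg (eval ![1 + c, 1]) h0
  simp [pointForm] at this

/-- **The `f`-side witness** (`R^{F_i}` is Gorenstein of socle `2d − 4` and `y₀ − cy₁ ∉ J^{F_i}`): if
`J^f = Ann(ℓ_f)` is Artinian Gorenstein of socle `2(d−2)` (`f` of degree `d ≥ 3`), there is a monomial `y^s` of
degree `2d − 5` with `ℓ_f(y^s·(y₀ − cy₁)) ≠ 0`. [cite: DuqueFrancoVillaflor2025Join, Theorem 7.2 (proof) and Definition 2.1 (iii)] -/
theorem exists_monomial_apply_mul_pointForm_ne_zero {f : MvPolynomial (Fin 2) K} (hf : f.IsHomogeneous d)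
    (hd : 3 ≤ d) {ℓf : MvPolynomial (Fin 2) K →ₗ[K] K}
    (hℓf : ∀ p, ℓf (homogeneousComponent (2 * (d - 2)) p) = ℓf p) (hJ : jacobianIdeal f = annIdeal ℓf)
    (hAG : IsArtinianGorenstein (jacobianIdeal f) (2 * (d - 2))) (c : K) :
    ∃ s : Fin 2 →₀ ℕ, s.degree = 2 * d - 5 ∧ ℓf (monomial s 1 * pointForm c) ≠ 0 := by
  have hL : (pointForm c).IsHomogeneous 1 :=
    (isHomogeneous_X K 0).sub ((isHomogeneous_C _ c).mul (isHomogeneous_X K 1))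
  -- by (iii) of Def. 2.1 there is a form `h` of degree `2d − 5` with `L·h ∉ J^f`, i.e. `ℓ_f(L·h) ≠ 0`
  have hex : ∃ h : MvPolynomial (Fin 2) K, h.IsHomogeneous (2 * d - 5) ∧ pointForm c * h ∉ jacobianIdeal f := by
    by_contra hcon
    push Not at hcon
    exact pointForm_notMem_jacobianIdeal hf hd c
      (hAG.mem_of_forall_mul_mem' (a := 1) (b := 2 * d - 5) (by omega) hL hcon)
  obtain ⟨h, hh, hnot⟩ := hex
  have hLh : (pointForm c * h).IsHomogeneous (2 * (d - 2)) := by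
    have := hL.mul hh
    rwa [show 1 + (2 * d - 5) = 2 * (d - 2) by omega] at this
  have hne : ℓf (h * pointForm c) ≠ 0 := by
    intro h0
    apply hnot
    rw [hJ, mem_annIdeal_iff_apply_eq_zero hℓf hLh, mul_comm]
    exact h0
  obtain ⟨s, hs, hs'⟩ := exists_monomial_of_apply_mul_ne_zero ℓf hne
  exact ⟨s, degree_eq_of_mem_support hh hs, hs'⟩

/-- **The `g`-side witness**: if `J^g = Ann(ℓ_g)` is Artinian Gorenstein of socle `σ_g` and some form `v` of degree
`t` has `v·P₂ ∉ J^g` (i.e. `HF_{δ'}(t) ≠ 0` for `(J^g : P₂) = J^{g,δ'}`), there are a monomial `x^β` of degree `t`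
and a form `w₂` with `ℓ_g(x^β·P₂·w₂) ≠ 0`. [cite: DuqueFrancoVillaflor2025Join, Theorem 1.3 (proof of (ii): "we choose `S` such that `S·P_{Z_2} ∉ J^g`"; = Theorem 4.1 of arXiv v4)] -/
theorem exists_monomial_apply_mul_mul_ne_zero [Fintype σ] {σg t e₂ : ℕ} {ℓg : MvPolynomial σ K →ₗ[K] K}
    (hℓg : ∀ p, ℓg (homogeneousComponent σg p) = ℓg p) {I : Ideal (MvPolynomial σ K)} (hI : I = annIdeal ℓg)
    (hAG : IsArtinianGorenstein I σg) {P₂ v : MvPolynomial σ K} (hP₂ : P₂.IsHomogeneous e₂)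
    (hvh : v.IsHomogeneous t) (hv : v * P₂ ∉ I) :
    ∃ (β : σ →₀ ℕ) (w₂ : MvPolynomial σ K), β.degree = t ∧ ℓg (monomial β 1 * P₂ * w₂) ≠ 0 := by
  -- `v P₂` has degree `t + e₂ ≤ σ_g` (forms of higher degree lie in `J^g`)
  have hle : t + e₂ ≤ σg := by
    by_contra hlt
    push Not at hlt
    apply hv
    have hmem : v * P₂ ∈ idealDegree I (t + e₂) := by
      rw [hAG.idealDegree_eq_of_lt hlt]
      exact (mem_homogeneousSubmodule _ _).mpr (hvh.mul hP₂)
    exact (mem_idealDegree.mp hmem).1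
  -- by (iii) some `w₂` of complementary degree has `v P₂ w₂ ∉ J^g`, i.e. `ℓ_g(v P₂ w₂) ≠ 0`
  have hex : ∃ w₂ : MvPolynomial σ K, w₂.IsHomogeneous (σg - (t + e₂)) ∧ v * P₂ * w₂ ∉ I := by
    by_contra hcon
    push Not at hcon
    exact hv (hAG.mem_of_forall_mul_mem' (a := t + e₂) (b := σg - (t + e₂)) (by omega) (hvh.mul hP₂) hcon)
  obtain ⟨w₂, hw₂, hnot⟩ := hex
  have hne : ℓg (v * (P₂ * w₂)) ≠ 0 := by
    intro h0
    apply hnot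
    rw [hI, mem_annIdeal_iff_apply_eq_zero hℓg (by
      simpa [show t + e₂ + (σg - (t + e₂)) = σg by omega] using (hvh.mul hP₂).mul hw₂), mul_assoc, h0]
  obtain ⟨β, hβ, hβ'⟩ := exists_monomial_of_apply_mul_ne_zero ℓg hne
  exact ⟨β, w₂, degree_eq_of_mem_support hvh hβ, by rwa [← mul_assoc] at hβ'⟩

end Monomials

/-! ## Theorem 7.2 (algebraic core): the degree-`d` piece of `q` does not vanish at a join with a fake factor -/

section Main

variable [Fintype σ] {g : MvPolynomial σ K} {f : MvPolynomial (Fin 2) K}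

/-- **Duque Franco–Villaflor, Thm. 7.2 — algebraic core (via eq. (eqQFFjoin) of Thm. 1.3 [arXiv v4: Thm. 4.1]).**
Let `F = g(x) + f(y₀,y₁)` with `g` a form whose Jacobian ideal `J^g` is Artinian Gorenstein (of socle `σ_g`;
`{g = 0}` smooth) and `f` a binary form of degree `d ≥ 3` with `J^f` Artinian Gorenstein of socle `2(d−2)`
(`{f = 0} ⊂ ℙ¹` reduced). Let `δ_i` be a `0`-dimensional FAKE linear cycle of `{f = 0}`: a point `c` with
`d·f(c,1) ≠ 0` and DFV's `P₁` (`P₁·(y₀ − cy₁) = aF_{y₀} − bF_{y₁}`, Thm. 7.1), and let `δ'` be any class of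
`{g = 0}` with polynomial `P₂` (a form of degree `e₂`) such that `HF_{δ'}(3) ≠ 0`, i.e. some form `v` of degree
`3` has `v·P₂ ∉ J^g` (for `δ'` a join of `n/2` point classes this is `3 ≤ (n/2)(d−2)`, i.e. the printed
hypothesis `d ≥ 2 + 6/n`). Then for the join `δ = J(δ', δ_i)` (`P_δ = P₂(x)P₁(y)`, Thm. 1.1) the degree-`d`
piece of Maclean's quadratic fundamental form does not vanish: there are forms `G = A·(y₀ − cy₁)`,
`H = B·(y₀ − cy₁)` of degree `d` in `(J^F : P_δ) = J^{F,δ}`, with legitimate lifts (`joinLift`), such that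
`q(G,H) = A·B·P₂·q_i(y₀ − cy₁, y₀ − cy₁) = −d·f(c,1)·A·B·P₂ ∉ J^F + ⟨P_δ⟩` — "the quadratic fundamental form
`q` associated to `V_δ` is non-zero in degree `d`, and so `V_δ` is not smooth" (the last inference is Maclean's
theorem, cited). [cite: DuqueFrancoVillaflor2025Join, Theorem 7.2 and Theorem 1.3 (ii) (= Theorem 4.1 of arXiv v4)] -/
theorem exists_macleanForm_join_notMem (hd : 3 ≤ d) (hf : f.IsHomogeneous d)
    (hJf : IsArtinianGorenstein (jacobianIdeal f) (2 * (d - 2))) {σg : ℕ}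
    (hJg : IsArtinianGorenstein (Ideal.span (Set.range fun i : σ => pderiv i g)) σg) {c : K}
    (hc : (d : K) * eval ![c, 1] f ≠ 0) {P₁ : MvPolynomial (Fin 2) K} (hP₁ : P₁ * pointForm c = dfvNumerator f c)
    {P₂ : MvPolynomial σ K} {e₂ : ℕ} (hP₂ : P₂.IsHomogeneous e₂)
    (hv : ∃ v : MvPolynomial σ K, v.IsHomogeneous 3 ∧ v * P₂ ∉ Ideal.span (Set.range fun i : σ => pderiv i g)) :
    ∃ A B : MvPolynomial (σ ⊕ Fin 2) K, A.IsHomogeneous (d - 1) ∧ B.IsHomogeneous (d - 1) ∧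
      (A * rename Sum.inr (pointForm c)).IsHomogeneous d ∧ (B * rename Sum.inr (pointForm c)).IsHomogeneous d ∧
      A * rename Sum.inr (pointForm c) ∈ (joinJacobian g f).colon {rename Sum.inl P₂ * rename Sum.inr P₁} ∧
      B * rename Sum.inr (pointForm c) ∈ (joinJacobian g f).colon {rename Sum.inl P₂ * rename Sum.inr P₁} ∧
      (A * rename Sum.inr (pointForm c) * (rename Sum.inl P₂ * rename Sum.inr P₁) =
          ∑ z, joinLift f c P₂ A z * pderiv z (joinForm g f)) ∧
      (B * rename Sum.inr (pointForm c) * (rename Sum.inl P₂ * rename Sum.inr P₁) =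
          ∑ z, joinLift f c P₂ B z * pderiv z (joinForm g f)) ∧
      macleanForm (A * rename Sum.inr (pointForm c)) (B * rename Sum.inr (pointForm c)) (joinLift f c P₂ A)
          (joinLift f c P₂ B) ∉ joinJacobian g f ⊔ Ideal.span {rename Sum.inl P₂ * rename Sum.inr P₁} := by
  classical
  -- Macaulay: `J^f = Ann ℓ_f`, `J^g = Ann ℓ_g`
  obtain ⟨ℓf, hℓf, -, hJf'⟩ := hJf.exists_eq_annIdeal
  obtain ⟨ℓg, hℓg, -, hJg'⟩ := hJg.exists_eq_annIdeal
  obtain ⟨v, hvh, hvn⟩ := hv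
  -- the two monomial witnesses
  obtain ⟨s, hsdeg, hs⟩ := exists_monomial_apply_mul_pointForm_ne_zero hf hd hℓf hJf' hJf c
  obtain ⟨β, w₂, hβdeg, hβ⟩ := exists_monomial_apply_mul_mul_ne_zero hℓg hJg' hJg hP₂ hvh hvn
  -- split the joint monomial `x^β y^s` (degree `3 + (2d−5) = 2(d−1)`) as `A·B`, `deg A = deg B = d − 1`
  set m : σ ⊕ Fin 2 →₀ ℕ := β.mapDomain Sum.inl + s.mapDomain Sum.inr with hm
  have hmdeg : m.degree = (d - 1) + (d - 1) := by
    rw [hm, map_add, Finsupp.degree_mapDomain, Finsupp.degree_mapDomain, hβdeg, hsdeg]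
    omega
  obtain ⟨m₁, hm₁le, hm₁deg⟩ := exists_le_degree_eq m (d - 1) (by omega)
  have hm₂deg : (m - m₁).degree = d - 1 := by
    have h := congrArg Finsupp.degree (add_tsub_cancel_of_le hm₁le)
    rw [map_add, hm₁deg, hmdeg] at h
    omega
  have hL : (pointForm c).IsHomogeneous 1 :=
    (isHomogeneous_X K 0).sub ((isHomogeneous_C _ c).mul (isHomogeneous_X K 1))
  have hL' : (rename (Sum.inr : Fin 2 → σ ⊕ Fin 2) (pointForm c)).IsHomogeneous 1 := hL.rename_isHomogeneous
  refine ⟨monomial m₁ 1, monomial (m - m₁) 1, isHomogeneous_monomial _ hm₁deg, isHomogeneous_monomial _ hm₂deg,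
    ?_, ?_, mul_pointForm_mem_colon hP₁ P₂ _, mul_pointForm_mem_colon hP₁ P₂ _,
    mul_pointForm_mul_eq_sum_joinLift hP₁ P₂ _, mul_pointForm_mul_eq_sum_joinLift hP₁ P₂ _, ?_⟩
  · convert (isHomogeneous_monomial (R := K) 1 hm₁deg).mul hL' using 1
    omega
  · convert (isHomogeneous_monomial (R := K) 1 hm₂deg).mul hL' using 1
    omega
  · -- `q(G,H) = −d f(c,1) · (x^β P₂)(x) · y^s`, and the witness functional does not kill it
    have hq : macleanForm (monomial m₁ 1 * rename Sum.inr (pointForm c))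
        (monomial (m - m₁) 1 * rename Sum.inr (pointForm c)) (joinLift f c P₂ (monomial m₁ 1))
        (joinLift f c P₂ (monomial (m - m₁) 1)) =
        -C ((d : K) * eval ![c, 1] f) *
          (rename Sum.inl (monomial β (1 : K) * P₂) * rename Sum.inr (monomial s (1 : K))) := by
      rw [macleanForm_join_pointForm_eq hf, monomial_mul, one_mul, add_tsub_cancel_of_le hm₁le, hm,
        map_mul (rename (Sum.inl : σ → σ ⊕ Fin 2)) (monomial β (1 : K)) P₂, rename_monomial, rename_monomial,
        show monomial (Finsupp.mapDomain Sum.inl β + Finsupp.mapDomain Sum.inr s) (1 : K) =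
          monomial (Finsupp.mapDomain Sum.inl β) 1 * monomial (Finsupp.mapDomain Sum.inr s) 1 by
            rw [monomial_mul, one_mul]]
      ring
    rw [hq, joinJacobian_eq_sup, hJf', hJg']
    intro hmem
    have hunit : IsUnit (-C ((d : K) * eval ![c, 1] f) : MvPolynomial (σ ⊕ Fin 2) K) :=
      ((isUnit_iff_ne_zero.mpr hc).map C).neg
    have hmem' := (Ideal.unit_mul_mem_iff_mem _ hunit).mp hmem
    have hw₁ : pointForm c * P₁ ∈ annIdeal ℓf := by
      rw [mul_comm, hP₁, ← hJf']
      exact dfvNumerator_mem_jacobianIdeal f c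
    exact rename_mul_rename_notMem_sup_span hℓf hw₁ hs hβ hmem'

end Main

/-! ## A form of a given degree outside an ideal, from the Hilbert function -/

/-- If `dim S_t − dim I_t > 0` then some form of degree `t` is not in `I`. [folklore] -/
private theorem exists_isHomogeneous_notMem_of_hilbert_pos {ι : Type*} {I : Ideal (MvPolynomial ι K)} {t : ℕ}
    (h : 0 < finrank K (homogeneousSubmodule ι K t) - finrank K (idealDegree I t)) :
    ∃ v : MvPolynomial ι K, v.IsHomogeneous t ∧ v ∉ I := by
  by_contra hcon
  push Not at hcon
  have heq : idealDegree I t = homogeneousSubmodule ι K t :=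
    le_antisymm (idealDegree_le_homogeneousSubmodule I t) fun v hv =>
      mem_idealDegree.mpr ⟨hcon v ((mem_homogeneousSubmodule _ _).mp hv), (mem_homogeneousSubmodule _ _).mp hv⟩
  rw [heq, Nat.sub_self] at h
  exact lt_irrefl 0 h

/-! ## Theorem 7.2 on the printed hypersurfaces `{Σ_j ∏_i (x_{(j,0)} − r_{j,i}x_{(j,1)}) = 0}` -/

section Split

variable {m : ℕ}

/-- **"`HF_{δ'}(3) ≠ 0`" for a join `δ'` of `m` point-type classes iff `3 ≤ m(d−2)`** — i.e. `d ≥ 2 + 6/n` with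
`n = 2m` (`HF_{δ'} = φ^{*m} = ciHilbert [(d−1)^m]`, Ex. 6.1): then some form `v` of degree `3` has
`v·∏_j P_j ∉ J^{Σ F_j}`. [cite: DuqueFrancoVillaflor2025Join, Theorem 7.2 (hypothesis "`d ≥ 2 + 6/n`") and Example 6.1] -/
theorem exists_isHomogeneous_three_mul_prod_notMem {F : Fin m → MvPolynomial (Fin 2) K} (hd : 2 ≤ d)
    (hmd : 3 ≤ m * (d - 2)) (hF : ∀ j, (F j).IsHomogeneous d)
    (hJ : ∀ j, IsArtinianGorenstein (jacobianIdeal (F j)) (2 * (d - 2))) {c : Fin m → K}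
    (hc : ∀ j, eval ![c j, 1] (pderiv 0 (F j)) ≠ 0 ∨ eval ![c j, 1] (pderiv 1 (F j)) ≠ 0)
    {P : Fin m → MvPolynomial (Fin 2) K} (hPh : ∀ j, (P j).IsHomogeneous (d - 2)) (hP0 : ∀ j, P j ≠ 0)
    (hP : ∀ j, P j * pointForm (c j) ∈ jacobianIdeal (F j)) :
    ∃ v : MvPolynomial (Fin m × Fin 2) K, v.IsHomogeneous 3 ∧
      v * ∏ j, rename (R := K) (Prod.mk j) (P j) ∉ blockSumJacobian F := by
  have hpos : 0 < finrank K (homogeneousSubmodule (Fin m × Fin 2) K 3) -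
      finrank K (idealDegree ((blockSumJacobian F).colon {∏ j, rename (R := K) (Prod.mk j) (P j)}) 3) := by
    rw [hilbert_blockSumJacobian_colon hd hF hJ hc hPh hP0 hP 3, ← List.ofFn_const,
      ciHilbert_ofFn_pos_iff (fun _ : Fin m => d - 1) (fun _ => by omega)]
    simpa [Finset.sum_const, smul_eq_mul, show d - 1 - 1 = d - 2 by omega] using hmd
  obtain ⟨v, hvh, hv⟩ := exists_isHomogeneous_notMem_of_hilbert_pos hpos
  refine ⟨v, hvh, fun hmem => hv ?_⟩
  rw [Submodule.mem_colon_singleton, smul_eq_mul]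
  exact hmem

/-- **Duque Franco–Villaflor, Thm. 7.2 (algebraic core) for `X = {F_0(x) + ⋯ + F_{m−1}(x) + F_m(y₀,y₁) = 0}` with the
last factor fake.** Let `F_j = ∏_i(x − r_{j,i}y)` (`j < m`) and `f = ∏_i(y₀ − r_iy₁)` be split binary forms with
simple roots, `d ≥ 3`, `d ≠ 0` in `K`, `3 ≤ m(d − 2)` (i.e. `d ≥ 2 + 6/n`, `n = 2m`); let
`δ' = J(δ_0, …, δ_{m−1})` be any join of point-type classes (points `c_j`, polynomials `P_j`, genuine or fake)
and `δ_m` the `0`-dimensional FAKE linear cycle at `c ∉ {r_i}` (DFV's `P₁`). Then for `δ = J(δ', δ_m)`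
(`P_δ = ∏_j P_j(x_{(j,·)})·P₁(y)`) there are `G = A·(y₀ − cy₁)`, `H = B·(y₀ − cy₁)` of degree `d` in `(J^F : P_δ)`,
with legitimate Maclean lifts, such that `q(G,H) ∉ J^F + ⟨P_δ⟩`: the degree-`d` piece of the quadratic
fundamental form of `V_δ` does not vanish (hence, by Maclean's theorem — cited — `V_δ` is not smooth / is
non-reduced or singular). [cite: DuqueFrancoVillaflor2025Join, Theorem 7.2] -/
theorem splitHypersurface_macleanForm_notMem {r : Fin m → Fin d → K} (hr : ∀ j, Function.Injective (r j))
    {r₀ : Fin d → K} (hr₀ : Function.Injective r₀) (hd : 3 ≤ d) (hdK : (d : K) ≠ 0) (hmd : 3 ≤ m * (d - 2))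
    {c : K} (hc : ∀ i, c ≠ r₀ i) {P₁ : MvPolynomial (Fin 2) K}
    (hP₁ : P₁ * pointForm c = dfvNumerator (splitForm r₀) c) {c' : Fin m → K}
    {P : Fin m → MvPolynomial (Fin 2) K} (hPh : ∀ j, (P j).IsHomogeneous (d - 2)) (hP0 : ∀ j, P j ≠ 0)
    (hP : ∀ j, P j * pointForm (c' j) ∈ jacobianIdeal (splitForm (r j))) :
    ∃ A B : MvPolynomial ((Fin m × Fin 2) ⊕ Fin 2) K, A.IsHomogeneous (d - 1) ∧ B.IsHomogeneous (d - 1) ∧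
      (A * rename Sum.inr (pointForm c)).IsHomogeneous d ∧ (B * rename Sum.inr (pointForm c)).IsHomogeneous d ∧
      A * rename Sum.inr (pointForm c) ∈ (joinJacobian (blockSum fun j => splitForm (r j)) (splitForm r₀)).colon
          {rename Sum.inl (∏ j, rename (R := K) (Prod.mk j) (P j)) * rename Sum.inr P₁} ∧
      B * rename Sum.inr (pointForm c) ∈ (joinJacobian (blockSum fun j => splitForm (r j)) (splitForm r₀)).colon
          {rename Sum.inl (∏ j, rename (R := K) (Prod.mk j) (P j)) * rename Sum.inr P₁} ∧
      (A * rename Sum.inr (pointForm c) * (rename Sum.inl (∏ j, rename (R := K) (Prod.mk j) (P j)) * rename Sum.inr P₁) =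
          ∑ z, joinLift (splitForm r₀) c (∏ j, rename (R := K) (Prod.mk j) (P j)) A z *
            pderiv z (joinForm (blockSum fun j => splitForm (r j)) (splitForm r₀))) ∧
      (B * rename Sum.inr (pointForm c) * (rename Sum.inl (∏ j, rename (R := K) (Prod.mk j) (P j)) * rename Sum.inr P₁) =
          ∑ z, joinLift (splitForm r₀) c (∏ j, rename (R := K) (Prod.mk j) (P j)) B z *
            pderiv z (joinForm (blockSum fun j => splitForm (r j)) (splitForm r₀))) ∧
      macleanForm (A * rename Sum.inr (pointForm c)) (B * rename Sum.inr (pointForm c))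
          (joinLift (splitForm r₀) c (∏ j, rename (R := K) (Prod.mk j) (P j)) A)
          (joinLift (splitForm r₀) c (∏ j, rename (R := K) (Prod.mk j) (P j)) B) ∉
        joinJacobian (blockSum fun j => splitForm (r j)) (splitForm r₀) ⊔
          Ideal.span {rename Sum.inl (∏ j, rename (R := K) (Prod.mk j) (P j)) * rename Sum.inr P₁} := by
  have hd2 : 2 ≤ d := by omega
  have hF : ∀ j, (splitForm (r j)).IsHomogeneous d := fun j => isHomogeneous_splitForm (r j)
  have hJ : ∀ j, IsArtinianGorenstein (jacobianIdeal (splitForm (r j))) (2 * (d - 2)) := fun j =>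
    isArtinianGorenstein_jacobianIdeal_splitForm (hr j) hd2 hdK
  have hc' : ∀ j, eval ![c' j, 1] (pderiv 0 (splitForm (r j))) ≠ 0 ∨
      eval ![c' j, 1] (pderiv 1 (splitForm (r j))) ≠ 0 := fun j => eval_pderiv_splitForm_ne_zero (hr j) hdK (c' j)
  have hP₂ : (∏ j, rename (R := K) (Prod.mk j) (P j) : MvPolynomial (Fin m × Fin 2) K).IsHomogeneous
      (∑ j : Fin m, (d - 2)) :=
    IsHomogeneous.prod _ _ _ fun j _ => (hPh j).rename_isHomogeneous
  exact exists_macleanForm_join_notMem hd (isHomogeneous_splitForm r₀)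
    (isArtinianGorenstein_jacobianIdeal_splitForm hr₀ hd2 hdK) (isArtinianGorenstein_blockSumJacobian hJ)
    (mul_ne_zero hdK ((eval_splitForm_ne_zero_iff r₀ c).mpr hc)) hP₁ hP₂
    (exists_isHomogeneous_three_mul_prod_notMem hd2 hmd hF hJ hc' hPh hP0 hP)

end Split

end Literature.AlgebraicGeometry.DuqueFrancoVillaflor2025

end
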